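import Summits.ABC.ABC.Theses.FeketeScales
import Summits.ABC.ABC.Theorems.FeketeScalesSubmultOfRST
import Summits.ABC.ABC.Theorems.FeketeScalesScaleSubmultiplicativityGrowthExponent

/-!
# Crux-strategist companion (seat s1) — `ScaleSubmultiplicativity` (stmt-ABC-2160), STRATEGY-CENSUS-s1.md

Seat planner-cstrat-stmt-ABC-2160-s1-0 (gen-1 re-arm on the staffed route, 2026-08-17).  This file TYPES the
objects the census argues about and kernel-checks the cheap implications; it proves nothing of the crux.
It complements `StrategySplit.lean` (seat p1: `CruxOn`, regime splits D4/D5, `SubPower`, …) and does not repeat it.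

* §1  THE CONDITIONAL ("INDUCTIVE") READING OF THE CRUX.  The route's Assembly
  (`Theorems/FeketeScalesAssembly.lean`, `doubling` / `allScales`) consumes the crux only through the hypothesis
  `mul : P S₁ X₁ → P S₂ X₂ → P (S₁S₂) (e^L e^{(log S₁S₂)^θ} X₁ X₂)` on the predicate
  `P S X :=` "every abc triple of radical `≤ S` has `c ≤ X`".  `TwoBoundPropagation` is that hypothesis as a
  Prop; `twoBound_iff_scaleSubmultiplicativity` shows it is the crux itself (⟸ shadows are bounded by the `Xᵢ`;
  ⟹ instantiate `Xᵢ := G(Rᵢ)`, attained by abc.S25 = `GrowthExponent.exists_extremalHeight`).  So the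
  "abc by induction on the radical scale" reading with TWO free bounds is a costume of the crux.
  With ONE common exponent `λ ∈ [1, 1+δ₀]` it is not: `NearGoodPropagation δ₀` ("near-goodness propagates")
  is implied by the crux (`nearGoodPropagation_of_scaleSubmultiplicativity`), holds VACUOUSLY in every world
  without large `(1+δ₀)`-good scales (`nearGoodPropagation_of_eventually_bad`) — so, unlike the crux
  (stmt-ABC-2163: crux ⟹ polynomial abc), it has no kernel-visible pointwise consequence — and still feeds a
  Fekete-type assembly `NapAssembly` (stated; proof sketch in the census §R4, a support-size item for provers).
* §2  COMPOSITION EXISTS UPWARD.  The squaring map `(a,b,c) ↦ (a², b(a+c), c²)` is an abc triple of radical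
  `≤ rad(abc)·(a+c) < 2c·rad(abc)` (`isABCTriple_sq`, `rad_sq_le`, `exists_sq_above`): the G-free form of the
  free diagonal SUPER-multiplicativity `G(2R·G(R)) ≥ G(R)²` (BarrierNotes-r1-k1 §7(a), stated there, proved here).
  The census (§Transfer T8/T4) uses it to state the asymmetry exactly: the abc equation has a composition
  (lower envelope of `G` understood: Stewart–Tijdeman, Bright) and no restriction (upper envelope = the crux).

All over tree vocabulary (`IsABCTriple`, `rad`, the route decls); Mathlib only otherwise.
-/

-- `Summit.<Summit>.<Problem>` is the mandated summit-side namespace (CONVENTIONS §2).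
set_option linter.dupNamespace false

namespace Summit.ABC.ABC.Cruxes.ScaleSubmultiplicativity.StrategistS1

open Literature.NumberTheory.DiophantineGeometry
open Summit.ABC.ABC.Theses.FeketeScales
open Summit.ABC.ABC.Theorems

/-! ## §1  The conditional reading of the crux -/

/-- `Good S X`: every abc triple of radical `≤ S` has height `≤ X` (the Assembly's predicate `P S X`;
"`S` is a good scale with bound `X`"). -/
def Good (S : ℕ) (X : ℝ) : Prop :=
  ∀ a b c : ℕ, IsABCTriple a b c → rad a b c ≤ S → (c : ℝ) ≤ X

/-- `Good` is monotone in the bound. [folklore] -/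
theorem Good.mono {S : ℕ} {X Y : ℝ} (h : Good S X) (hXY : X ≤ Y) : Good S Y :=
  fun a b c ht hr => (h a b c ht hr).trans hXY

/-- TWO-BOUND PROPAGATION (the Assembly's hypothesis `mul` as a Prop): goodness of two scales with ARBITRARY
bounds `X₁, X₂` propagates to the product scale with the crux's slack. -/
def TwoBoundPropagation : Prop :=
  ∃ θ : ℝ, θ < 1 ∧ ∃ K : ℝ, 0 < K ∧ ∃ R₀ : ℕ, ∀ R₁ R₂ : ℕ, R₀ ≤ R₁ → R₀ ≤ R₂ → ∀ X₁ X₂ : ℝ,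
    Good R₁ X₁ → Good R₂ X₂ →
      Good (R₁ * R₂) (K * Real.exp (Real.log ((R₁ : ℝ) * R₂) ^ θ) * X₁ * X₂)

/-- crux ⟹ two-bound propagation: the shadows are bounded by the bounds. [folklore] -/
theorem twoBound_of_scaleSubmultiplicativity (h : ScaleSubmultiplicativity) : TwoBoundPropagation := by
  obtain ⟨θ, hθ, K, hK, R₀, h⟩ := h
  refine ⟨θ, hθ, K, hK, R₀, fun R₁ R₂ hR₁ hR₂ X₁ X₂ g₁ g₂ a b c habc hrad => ?_⟩
  obtain ⟨a₁, b₁, c₁, a₂, b₂, c₂, t₁, r₁, t₂, r₂, hle⟩ := h R₁ R₂ hR₁ hR₂ a b c habc hrad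
  have hc₁ : (c₁ : ℝ) ≤ X₁ := g₁ a₁ b₁ c₁ t₁ r₁
  have hc₂ : (c₂ : ℝ) ≤ X₂ := g₂ a₂ b₂ c₂ t₂ r₂
  have hc₁0 : (0 : ℝ) ≤ c₁ := Nat.cast_nonneg _
  have hc₂0 : (0 : ℝ) ≤ c₂ := Nat.cast_nonneg _
  have hs : 0 ≤ K * Real.exp (Real.log ((R₁ : ℝ) * R₂) ^ θ) := mul_nonneg hK.le (Real.exp_pos _).le
  calc (c : ℝ) ≤ K * Real.exp (Real.log ((R₁ : ℝ) * R₂) ^ θ) * c₁ * c₂ := hle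
    _ ≤ K * Real.exp (Real.log ((R₁ : ℝ) * R₂) ^ θ) * X₁ * X₂ :=
        mul_le_mul (mul_le_mul_of_nonneg_left hc₁ hs) hc₂ hc₂0 (mul_nonneg hs (hc₁0.trans hc₁))

/-- two-bound propagation ⟹ crux: instantiate the bounds with the extremal heights `G(R₁), G(R₂)`, which are
attained (abc.S25, PROVED: `ScaleSubmultiplicativity.GrowthExponent.exists_extremalHeight`). [folklore] -/
theorem scaleSubmultiplicativity_of_twoBound (h : TwoBoundPropagation) : ScaleSubmultiplicativity := by
  obtain ⟨θ, hθ, K, hK, R₀, h⟩ := h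
  obtain ⟨G, hGub, hGatt⟩ := ScaleSubmultiplicativity.GrowthExponent.exists_extremalHeight
  refine ⟨θ, hθ, K, hK, max R₀ 2, fun R₁ R₂ hR₁ hR₂ a b c habc hrad => ?_⟩
  have good₁ : Good R₁ (G R₁) := fun a b c ht hr => by exact_mod_cast hGub a b c R₁ ht hr
  have good₂ : Good R₂ (G R₂) := fun a b c ht hr => by exact_mod_cast hGub a b c R₂ ht hr
  have hle := h R₁ R₂ ((le_max_left _ _).trans hR₁) ((le_max_left _ _).trans hR₂) _ _ good₁ good₂
    a b c habc hrad
  obtain ⟨a₁, b₁, t₁, r₁⟩ := hGatt R₁ ((le_max_right _ _).trans hR₁)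
  obtain ⟨a₂, b₂, t₂, r₂⟩ := hGatt R₂ ((le_max_right _ _).trans hR₂)
  exact ⟨a₁, b₁, G R₁, a₂, b₂, G R₂, t₁, r₁, t₂, r₂, hle⟩

/-- **The two-bound conditional reading is the crux itself.** [folklore] -/
theorem twoBound_iff_scaleSubmultiplicativity : TwoBoundPropagation ↔ ScaleSubmultiplicativity :=
  ⟨scaleSubmultiplicativity_of_twoBound, twoBound_of_scaleSubmultiplicativity⟩

/-- NEAR-GOOD PROPAGATION `NAP(δ₀)`: goodness of two scales with ONE COMMON exponent `λ ∈ [1, 1+δ₀]`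
propagates to the product scale with sub-power loss.  Weaker than the crux (one exponent, restricted window);
exactly what a Fekete iteration from a `(1+δ)`-good seed scale consumes (`NapAssembly`). -/
def NearGoodPropagation (δ₀ : ℝ) : Prop :=
  ∃ θ : ℝ, θ < 1 ∧ ∃ K : ℝ, 0 < K ∧ ∃ R₀ : ℕ, ∀ R₁ R₂ : ℕ, R₀ ≤ R₁ → R₀ ≤ R₂ → ∀ l : ℝ, 1 ≤ l →
    l ≤ 1 + δ₀ → Good R₁ ((R₁ : ℝ) ^ l) → Good R₂ ((R₂ : ℝ) ^ l) →
      Good (R₁ * R₂) (K * Real.exp (Real.log ((R₁ : ℝ) * R₂) ^ θ) * ((R₁ : ℝ) * R₂) ^ l)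

/-- two-bound ⟹ near-good propagation (take `Xᵢ := Rᵢ^λ`). [folklore] -/
theorem nearGoodPropagation_of_twoBound (h : TwoBoundPropagation) (δ₀ : ℝ) : NearGoodPropagation δ₀ := by
  obtain ⟨θ, hθ, K, hK, R₀, h⟩ := h
  refine ⟨θ, hθ, K, hK, R₀, fun R₁ R₂ hR₁ hR₂ l _ _ g₁ g₂ a b c habc hrad => ?_⟩
  have hle := h R₁ R₂ hR₁ hR₂ _ _ g₁ g₂ a b c habc hrad
  rw [Real.mul_rpow (Nat.cast_nonneg R₁) (Nat.cast_nonneg R₂)]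
  simpa [mul_assoc] using hle

/-- crux ⟹ near-good propagation, for every window `δ₀`. [folklore] -/
theorem nearGoodPropagation_of_scaleSubmultiplicativity (h : ScaleSubmultiplicativity) (δ₀ : ℝ) :
    NearGoodPropagation δ₀ :=
  nearGoodPropagation_of_twoBound (twoBound_of_scaleSubmultiplicativity h) δ₀

/-- **Vacuity of `NAP` in a world without good scales.**  If from some scale on no scale is `(1+δ₀)`-good
(for instance if abc fails with a definite power law at every large scale, or if `G(R) > R^{1+δ₀}` for all
large `R`), then `NearGoodPropagation δ₀` holds trivially (its hypotheses are never met).  Hence `NAP(δ₀)` has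
NO pointwise consequence visible to the kernel — in contrast with the crux, which implies polynomial abc
(stmt-ABC-2163) because its hypothesis-free form iterates from any finite scale. [folklore] -/
theorem nearGoodPropagation_of_eventually_bad {δ₀ : ℝ}
    (h : ∃ N : ℕ, ∀ R : ℕ, N ≤ R → ¬ Good R ((R : ℝ) ^ (1 + δ₀))) : NearGoodPropagation δ₀ := by
  obtain ⟨N, hN⟩ := h
  refine ⟨0, zero_lt_one, 1, one_pos, max N 1, fun R₁ R₂ hR₁ _ l _ hl1 g₁ _ => ?_⟩
  exfalso
  have hR₁1 : (1 : ℝ) ≤ (R₁ : ℝ) := by exact_mod_cast (le_max_right _ _).trans hR₁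
  have hmono : (R₁ : ℝ) ^ l ≤ (R₁ : ℝ) ^ (1 + δ₀) := Real.rpow_le_rpow_of_exponent_le hR₁1 hl1
  exact hN R₁ ((le_max_left _ _).trans hR₁) (g₁.mono hmono)

/-- `NAP`: near-good propagation in SOME window. -/
def NAP : Prop := ∃ δ₀ : ℝ, 0 < δ₀ ∧ NearGoodPropagation δ₀

/-- crux ⟹ NAP. [folklore] -/
theorem nap_of_scaleSubmultiplicativity (h : ScaleSubmultiplicativity) : NAP :=
  ⟨1, one_pos, nearGoodPropagation_of_scaleSubmultiplicativity h 1⟩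

/-- **The replacement assembly (census §R4), as a statement.**  `NAP → SparseGoodScales → ABC`: the Fekete
iteration of `Theorems/FeketeScalesAssembly.lean` run with ONE common exponent.  Sketch (elementary, est.
300–450 lines, a support item for provers if the tenure planner re-cuts the route): fix `ε`, `δ := min(ε, δ₀)/4`,
take a `(1+δ)`-good scale `R*` with `t₀ := log R* ` large; let `E_i := sup {e(N) : N < 2^{i+1}}` where
`e(N)` is the least exponent with `Good (R*^N) ((R*^N)^{e(N)})` produced so far; combining `R*^{2^i}` with
`R*^M` (`M < 2^i`) at the common exponent `max(e(2^i), e(M)) ≤ E_{i-1}` plus the dyadic step give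
`E_i ≤ E_{i-1} + 2 (log K + (2^i t₀)^θ)/(2^i t₀)`, a summable series: all exponents stay
`≤ 1 + δ + 2 log K/t₀ + C_θ t₀^{θ-1} ≤ 1 + 2δ ≤ 1 + δ₀` for `t₀` large, so every application of `NAP` is
licit; a triple of radical `r` is bounded through the least `N` with `R*^N ≥ r` as in the Assembly. -/
def NapAssembly : Prop := NAP → SparseGoodScales → _root_.ABC

/-! ## §2  Composition exists upward: the squaring map -/

/-- **The squaring map.**  If `(a, b, c)` is an abc triple then so is `(a², b(a+c), c²)`
(`c² = a² + b(a + c)` since `c = a + b`; `gcd(a², b(a+c)) = 1` from `gcd(a,b) = gcd(a,c) = 1`). [folklore] -/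
theorem isABCTriple_sq {a b c : ℕ} (h : IsABCTriple a b c) : IsABCTriple (a ^ 2) (b * (a + c)) (c ^ 2) := by
  obtain ⟨ha, hb, habc, hcop⟩ := h
  refine ⟨by positivity, Nat.mul_pos hb (by omega), ?_, ?_⟩
  · subst habc; ring
  · have hac : Nat.Coprime a c := by
      rw [← habc, add_comm]
      exact Nat.coprime_add_self_right.mpr hcop
    have hac' : Nat.Coprime a (a + c) := Nat.coprime_self_add_right.mpr hac
    exact Nat.Coprime.pow_left 2 (Nat.Coprime.mul_right hcop hac')

/-- Radical of the squared triple: `rad(a² · b(a+c) · c²) ≤ rad(abc) · (a + c)` (same prime support as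
`abc·(a+c)`). [folklore] -/
theorem rad_sq_le {a b c : ℕ} (h : IsABCTriple a b c) :
    rad (a ^ 2) (b * (a + c)) (c ^ 2) ≤ rad a b c * (a + c) := by
  obtain ⟨ha, hb, habc, _⟩ := h
  have ha0 : a ≠ 0 := ha.ne'
  have hb0 : b ≠ 0 := hb.ne'
  have hc0 : c ≠ 0 := by omega
  have hac0 : a + c ≠ 0 := by omega
  rw [rad_def, rad_def]
  have hk : UniqueFactorizationMonoid.radical (a * b * c) * (a + c) ≠ 0 :=
    mul_ne_zero UniqueFactorizationMonoid.radical_ne_zero hac0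
  apply Nat.le_of_dvd (Nat.pos_of_ne_zero hk)
  rw [Nat.radical_dvd_iff hk]
  intro p hp
  have hp' := Nat.mem_primeFactors.mp hp
  obtain ⟨hpp, hpdvd, -⟩ := hp'
  rw [Nat.mem_primeFactors]
  refine ⟨hpp, ?_, hk⟩
  -- `p ∣ a² · (b (a+c)) · c²` ⟹ `p ∣ abc` or `p ∣ a + c`
  have hcases : p ∣ a * b * c ∨ p ∣ a + c := by
    rcases (Nat.Prime.dvd_mul hpp).mp hpdvd with h1 | h1
    · rcases (Nat.Prime.dvd_mul hpp).mp h1 with h2 | h2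
      · left
        have : p ∣ a := Nat.Prime.dvd_of_dvd_pow hpp h2
        exact Dvd.dvd.mul_right (Dvd.dvd.mul_right this b) c
      · rcases (Nat.Prime.dvd_mul hpp).mp h2 with h3 | h3
        · left
          exact Dvd.dvd.mul_right (Dvd.dvd.mul_left h3 a) c
        · right; exact h3
    · left
      have : p ∣ c := Nat.Prime.dvd_of_dvd_pow hpp h1
      exact Dvd.dvd.mul_left this (a * b)
  rcases hcases with h1 | h1
  · -- prime divisors of `abc` divide its radical
    have hmem : p ∈ (UniqueFactorizationMonoid.radical (a * b * c)).primeFactors := by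
      rw [Nat.primeFactors_radical]
      exact Nat.mem_primeFactors.mpr ⟨hpp, h1, by positivity⟩
    exact Dvd.dvd.mul_right (Nat.dvd_of_mem_primeFactors hmem) (a + c)
  · exact Dvd.dvd.mul_left h1 _

/-- **Upward composition, G-free** (diagonal super-multiplicativity `G(2R·G(R)) ≥ G(R)²`, BarrierNotes-r1-k1
§7(a)): every abc triple `T₀` of radical `ρ` and height `c₀` produces an abc triple of radical `≤ ρ · 2c₀` and
height `c₀²`. [folklore] -/
theorem exists_sq_above {a b c : ℕ} (h : IsABCTriple a b c) :
    ∃ a' b' c' : ℕ, IsABCTriple a' b' c' ∧ rad a' b' c' ≤ rad a b c * (2 * c) ∧ c' = c ^ 2 := by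
  have hle : a + c ≤ 2 * c := by obtain ⟨_, hb, habc, _⟩ := h; omega
  exact ⟨a ^ 2, b * (a + c), c ^ 2, isABCTriple_sq h,
    (rad_sq_le h).trans (Nat.mul_le_mul_left _ hle), rfl⟩

end Summit.ABC.ABC.Cruxes.ScaleSubmultiplicativity.StrategistS1
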